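import Summits.CriticalPhenomena.PercolationContinuityZ3.Theorems.Transplant.SkelFrmQuasiBParamsFaceFloorsAYA
import Summits.CriticalPhenomena.PercolationContinuityZ3.Theorems.Transplant.SkelFrmBParamsFaceFloorsAYA
import Summits.CriticalPhenomena.PercolationContinuityZ3.Theorems.Transplant.PlanarSkeletonFrmQuasiDefs
import Summits.CriticalPhenomena.PercolationContinuityZ3.Theorems.Transplant.PlanarSkeletonFrmDefs
import Summits.CriticalPhenomena.PercolationContinuityZ3.Theorems.Transplant.SkelPhiStepIDataNS
import Summits.CriticalPhenomena.PercolationContinuityZ3.Theorems.Transplant.SkelFrmQuasi1ChoiceDefs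
import Summits.CriticalPhenomena.PercolationContinuityZ3.Theorems.Transplant.SkelFrmQuasi1ParamsLBL
import Summits.CriticalPhenomena.PercolationContinuityZ3.Theorems.Transplant.SkelFrmQuasiBChoiceNums
import Summits.CriticalPhenomena.PercolationContinuityZ3.Theorems.Transplant.SkelFrmQuasiBParamsFaceCountsRangeA
import Summits.CriticalPhenomena.PercolationContinuityZ3.Theorems.Transplant.SkelFrmQuasiBParamsFaceFloorsTYA
import Summits.CriticalPhenomena.PercolationContinuityZ3.Theorems.Transplant.SkelFrmQuasiBParamsFaceUnits
import Summits.CriticalPhenomena.PercolationContinuityZ3.Theorems.Transplant.SkelFrmQuasiBParamsLF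
import Summits.CriticalPhenomena.PercolationContinuityZ3.Theorems.Transplant.SkelFrmQuasiBParamsLFA
import HarnessLib
import Summits.CriticalPhenomena.PercolationContinuityZ3.Theorems.Transplant.SkelFrmBParamsFaceFloorsFAYA
/-!
# GEN-Q PORT (WAVE-Q table v0.8 section 2, row G195, U-level L20; captain R-6/R-7 2026-08-27: carrier token swap `PlanarSkeletonFrmFrom ↦ PlanarSkeletonFrmQuasi`)
# of the tree module «Transplant/SkelFrmFromBParamsFaceFloorsFAYA» (sha256 6dc8c19e4b3fdb3f…) onto the quasi-step carrier `PlanarSkeletonFrmQuasi` (p507026): «SkelFrmQuasiBParamsFaceFloorsFAYA»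

HAND HUNK (L-FLOORMAP-1 ①⑥ / L-KitS-1 reader side; G017 «SkelFrmQuasiBChoiceNums», hp-8's KitSN): KS0.R'0→KS0.R'0N×33 — the kit of record at window cost `KS.NQ Φ`.

ORIGINAL TITLE: (F) VALUE LAYER, N2 twin (hp-8 g42, 2026-08-23; F-DISCHARGE-MAP-N2 G18; (R-22)/E6): `port_frm.py` text of N1 `SkelNegBParamsFaceFloorsFAYA` (stmt-g16) — y′-face along floors FA1–FA4 over AYA-N2 (generic PCells2T; F1cA_abs_le, ySBox_err_le_Y);

builds on p205010 (kernel theorem, internal audit signed; external expert review pending) — nothing in this file uses p205010; NOTHING is claimed about any open node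
((N3-b), the end state).  Lane `prim-bschramm`, seat `prim-bschramm-stmt` (gen 33; GEN-Q column pen; tool = captain gen-1 g4's port_genq.py R-14 --cone + p3-g30's T1 patch).  Helper file (`--supports stmt-CriticalPhenomena-4575 --as helper`).
PORT RULES (U-wave r1–r4 re-used, GEN-Q hunk classes of p3-g29 #6136): declaration order, names and proof texts are those of «SkelFrmFromBParamsFaceFloorsFAYA», byte-identical except
(i) the carrier token `PlanarSkeletonFrmFrom ↦ PlanarSkeletonFrmQuasi` in binders, `namespace`/`end` lines and qualified names (module names `SkelFrmFrom… ↦ SkelFrmQuasi…`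
in imports of already-ported rows); (ii) `Φ.step ↦ Φ.qstep` with the called Steps lemma replaced by its `…Q`/`_q` twin and the cost `Φ.M` threaded (none in this file unless
listed below); (iii) `Φ.cyl_connected ↦ Φ.cyl_reach` readers (none unless listed); (iv) graph-ball radii / window floors ×`Φ.M` (none unless listed).  Carrier-free
residents stay imported/exported from the original «SkelFrmBParamsFaceFloorsFAYA» exactly as in the FrmFrom port.  Docstrings and citations are the original's.

-/

noncomputable section

open scoped Classical

namespace Summit.CriticalPhenomena.PercolationContinuityZ3.Theorems.Transplant

namespace PlanarSkeletonFrmQuasi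

namespace NegB

open Literature.Probability.Percolation Literature.Probability.LatticeModels SimpleGraph
open SkelConc (Consts)
open Skelφ (shearUnit shearUnit_pos yBoxLoS yBoxHiS ySLo ySHi yBnd)
open Skelφ.StepI (DataN)
open TwoAxis.Para (modulus)
open Neg

namespace KS

section FloorsAY

/-! ## §1 Sizes at the y′-face tuple (start half-height `qB` generic under `4·U·qB ≤ 5·n_Lℓ_L`) -/

/-- **The level-box envelope's size at the y′-face tuple**: `Err(qB, RA′, k) + U ≤ 5·m` for `k + 1 ≤ 1000·Kq`, under `4·(U·qB) ≤ 5·(n_Lℓ_L)`,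
`22000·Kq·(RA′+2) ≤ ℓ_L`, `|h_L| ≤ 10n_L` (`Err := 2kU + U·qB + U·(k+1)·RA′ + 3n_Lℓ_L + U`). [folklore] -/
theorem ySBox_err_le_Y (κ : Consts) {V : Type} [DecidableEq V] [Countable V] {G : SimpleGraph V} [G.LocallyFinite] (Φ : PlanarSkeletonFrmQuasi G) (t : V) (p : unitInterval) (D : Skelφ.StepI.DataNS V) (g : ℕ) (f : ℕ) (mk : ℕ) (hN : EqNumL κ Φ t p D g f) (hκ : (hL κ Φ t p D g f).natAbs ≤ 10 * nL κ Φ t p D g f)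
    (hℓ : 22000 * Neg.Kq κ * (KS0.R'0N κ Φ (KS.NQ Φ) t p D mk + 2) ≤ ℓL κ Φ t p D g f) {qB : ℕ}
    (hqB : 4 * ((shearUnit (nL κ Φ t p D g f) (hL κ Φ t p D g f) : ℤ) * (qB : ℤ)) ≤ 5 * ((nL κ Φ t p D g f : ℤ) * ℓL κ Φ t p D g f))
    {k : ℕ} (hk : k + 1 ≤ 1000 * Neg.Kq κ) :
    (2 * (k : ℤ) * (shearUnit (nL κ Φ t p D g f) (hL κ Φ t p D g f) : ℤ) + (shearUnit (nL κ Φ t p D g f) (hL κ Φ t p D g f) : ℤ) * (qB : ℕ) +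
          (shearUnit (nL κ Φ t p D g f) (hL κ Φ t p D g f) : ℤ) * (((k : ℤ) + 1) * (KS0.R'0N κ Φ (KS.NQ Φ) t p D mk : ℕ)) + 3 * ((nL κ Φ t p D g f : ℤ) * ℓL κ Φ t p D g f) +
        shearUnit (nL κ Φ t p D g f) (hL κ Φ t p D g f)) + shearUnit (nL κ Φ t p D g f) (hL κ Φ t p D g f) ≤
      5 * modulus (nL κ Φ t p D g f) (hL κ Φ t p D g f) (vL κ Φ t p D g f) (vβL κ Φ t p D g f) := by
  obtain ⟨hn1, hℓ1⟩ := one_le_of_eqNumL κ Φ t p D g f hN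
  have hmm := Skelφ.NegPrm.modulus_vβOf hn1 (hL κ Φ t p D g f) (ℓL κ Φ t p D g f) (vL κ Φ t p D g f)
  have e : vβL κ Φ t p D g f = Skelφ.NegPrm.vβOf (nL κ Φ t p D g f) (hL κ Φ t p D g f) (ℓL κ Φ t p D g f) (vL κ Φ t p D g f) := rfl
  rw [← e] at hmm
  obtain ⟨hm1, -⟩ := hmm
  have hUe : (shearUnit (nL κ Φ t p D g f) (hL κ Φ t p D g f) : ℤ) = (nL κ Φ t p D g f : ℤ) + ((hL κ Φ t p D g f).natAbs : ℤ) := by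
    unfold Skelφ.shearUnit; push_cast; ring
  have h10 : (((hL κ Φ t p D g f).natAbs : ℕ) : ℤ) ≤ 10 * (nL κ Φ t p D g f : ℤ) := by exact_mod_cast hκ
  have hh0 : (0 : ℤ) ≤ ((hL κ Φ t p D g f).natAbs : ℤ) := Nat.cast_nonneg _
  have hℓ' : 22000 * (Neg.Kq κ : ℤ) * ((KS0.R'0N κ Φ (KS.NQ Φ) t p D mk : ℤ) + 2) ≤ (ℓL κ Φ t p D g f : ℤ) := by exact_mod_cast hℓ
  have hk' : (k : ℤ) + 1 ≤ 1000 * (Neg.Kq κ : ℤ) := by exact_mod_cast hk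
  clear hℓ hk hκ e
  have hn : (1 : ℤ) ≤ (nL κ Φ t p D g f : ℤ) := by exact_mod_cast hn1
  have hKq : (1 : ℤ) ≤ (Neg.Kq κ : ℤ) := by exact_mod_cast Neg.one_le_Kq κ
  have hR0 : (0 : ℤ) ≤ (KS0.R'0N κ Φ (KS.NQ Φ) t p D mk : ℤ) := Nat.cast_nonneg _
  have hk0 : (0 : ℤ) ≤ (k : ℤ) := Nat.cast_nonneg _
  have hq0 : (0 : ℤ) ≤ ((qB : ℕ) : ℤ) := Nat.cast_nonneg _
  set U : ℤ := (shearUnit (nL κ Φ t p D g f) (hL κ Φ t p D g f) : ℤ)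
  set n : ℤ := (nL κ Φ t p D g f : ℤ)
  set ℓ : ℤ := (ℓL κ Φ t p D g f : ℤ)
  set m := modulus (nL κ Φ t p D g f) (hL κ Φ t p D g f) (vL κ Φ t p D g f) (vβL κ Φ t p D g f)
  set Q : ℤ := (Neg.Kq κ : ℤ)
  set R : ℤ := (KS0.R'0N κ Φ (KS.NQ Φ) t p D mk : ℤ)
  have hU11 : U ≤ 11 * n := by rw [hUe]; linarith
  have hUn : n ≤ U := by rw [hUe]; linarith
  have hU0 : 0 ≤ U := by linarith
  have hQR : 0 ≤ Q * R := mul_nonneg (by linarith) hR0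
  -- `kU ≤ (1000Q − 1)·11n`, `U(k+1)R ≤ 11n·1000QR`, `U ≤ 11n`, `4·U·qB ≤ 5nℓ`
  have a1 : (k : ℤ) * U ≤ (1000 * Q - 1) * (11 * n) := mul_le_mul (by linarith) hU11 hU0 (by linarith)
  have a2 : U * (((k : ℤ) + 1) * R) ≤ (11 * n) * ((1000 * Q) * R) := mul_le_mul hU11 (mul_le_mul_of_nonneg_right hk' hR0) (mul_nonneg (by linarith) hR0) (by linarith)
  have key : n * (44000 * Q * (R + 2) + 20) ≤ n * (3 * ℓ) := mul_le_mul_of_nonneg_left (by nlinarith) (by linarith)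
  nlinarith

/-- The origin's along reading lies within `3u₁` of `0` when `|Λ₁(yL)| ≤ 3m`. [folklore] -/
theorem F1cA_abs_le (κ : Consts) {V : Type} [DecidableEq V] [Countable V] {G : SimpleGraph V} [G.LocallyFinite] (Φ : PlanarSkeletonFrmQuasi G) (t : V) (p : unitInterval) (D : Skelφ.StepI.DataNS V) (g : ℕ) (f : ℕ) (hN : EqNumL κ Φ t p D g f) (yL : Site 2)
    (hΛ₁ : |Λ₁of κ Φ t p D g f yL| ≤ 3 * modulus (nL κ Φ t p D g f) (hL κ Φ t p D g f) (vL κ Φ t p D g f) (vβL κ Φ t p D g f)) :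
    -(3 * u₁A κ Φ t p D g f) ≤ F1cA κ Φ t p D g f yL ∧ F1cA κ Φ t p D g f yL ≤ 3 * u₁A κ Φ t p D g f := by
  obtain ⟨hn1, hℓ1⟩ := one_le_of_eqNumL κ Φ t p D g f hN
  have hm0 : 0 < modulus (nL κ Φ t p D g f) (hL κ Φ t p D g f) (vL κ Φ t p D g f) (vβL κ Φ t p D g f) := Skelφ.NegPrm.modulus_vβOf_pos hn1 hℓ1 _ _
  have hu : 1 ≤ u₁A κ Φ t p D g f := (units_eqA κ Φ t p D g f).2.2.2.2.2
  have hF := F1cA_eq κ Φ t p D g f yL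
  obtain ⟨f1, f2⟩ := PlanarSkeletonNeg.NegB.RootArith.floor_sandwich (x := 2 * u₁A κ Φ t p D g f * Λ₁of κ Φ t p D g f yL + modulus (nL κ Φ t p D g f) (hL κ Φ t p D g f) (vL κ Φ t p D g f) (vβL κ Φ t p D g f))
    (d := 2 * modulus (nL κ Φ t p D g f) (hL κ Φ t p D g f) (vL κ Φ t p D g f) (vβL κ Φ t p D g f)) (by linarith)
  rw [← hF] at f1 f2
  set m := modulus (nL κ Φ t p D g f) (hL κ Φ t p D g f) (vL κ Φ t p D g f) (vβL κ Φ t p D g f)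
  set u := u₁A κ Φ t p D g f
  set F := F1cA κ Φ t p D g f yL
  obtain ⟨hΛa, hΛb⟩ := abs_le.1 hΛ₁
  have huΛ1 : u * (-(3 * m)) ≤ u * Λ₁of κ Φ t p D g f yL := mul_le_mul_of_nonneg_left hΛa (by linarith)
  have huΛ2 : u * Λ₁of κ Φ t p D g f yL ≤ u * (3 * m) := mul_le_mul_of_nonneg_left hΛb (by linarith)
  constructor
  · by_contra hc; push Not at hc
    have h1 : 2 * m * F ≤ 2 * m * (-(3 * u) - 1) := mul_le_mul_of_nonneg_left (by linarith) (by linarith)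
    nlinarith
  · by_contra hc; push Not at hc
    have h1 : 2 * m * (3 * u + 1) ≤ 2 * m * F := mul_le_mul_of_nonneg_left (by linarith) (by linarith)
    nlinarith

/-! ## §2 The along floors `FA1`–`FA4` (level boxes `ySLo/ySHi` at `(qB, RA′, σ, k)`) -/

/-- **`FA1` at the (ζ′) y′-face tuple** (`σ = 1`): the lower along reading of region `k` is above `flo` — from the origin's `|Λ₁(yL)| ≤ 3m`, the band
`5r₁ + 10u₁(j+1) − 1 − E ≤ lev`, `E ≤ 2RA′` and `6RA′ + 11 ≤ u₁`. [cite: KozmaNitzan2024, §4 Lemma 12 (pp. 23–25)] -/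
theorem FA1_YA (κ : Consts) {V : Type} [DecidableEq V] [Countable V] {G : SimpleGraph V} [G.LocallyFinite] (Φ : PlanarSkeletonFrmQuasi G) (t : V) (p : unitInterval) (D : Skelφ.StepI.DataNS V) (g : ℕ) (f : ℕ) (P : PCells2T) (mk : ℕ) (hN : EqNumL κ Φ t p D g f) (hκ : (hL κ Φ t p D g f).natAbs ≤ 10 * nL κ Φ t p D g f)
    (hℓ : 22000 * Neg.Kq κ * (KS0.R'0N κ Φ (KS.NQ Φ) t p D mk + 2) ≤ ℓL κ Φ t p D g f) (hs1 : 6 * (KS0.R'0N κ Φ (KS.NQ Φ) t p D mk : ℤ) + 11 ≤ u₁A κ Φ t p D g f) (yL : Site 2)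
    (hΛ₁ : |Λ₁of κ Φ t p D g f yL| ≤ 3 * modulus (nL κ Φ t p D g f) (hL κ Φ t p D g f) (vL κ Φ t p D g f) (vβL κ Φ t p D g f)) {qB : ℕ}
    (hqB : 4 * ((shearUnit (nL κ Φ t p D g f) (hL κ Φ t p D g f) : ℤ) * (qB : ℤ)) ≤ 5 * ((nL κ Φ t p D g f : ℤ) * ℓL κ Φ t p D g f))
    {lev E : ℤ} {j : ℕ} (hE : E ≤ 2 * (KS0.R'0N κ Φ (KS.NQ Φ) t p D mk : ℤ))
    (hlev : 5 * (P.r 1 : ℤ) + 10 * u₁A κ Φ t p D g f * ((j : ℤ) + 1) - 1 - E ≤ lev) {k : ℕ} (hk : k + 1 ≤ 1000 * Neg.Kq κ) :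
    modulus (nL κ Φ t p D g f) (hL κ Φ t p D g f) (vL κ Φ t p D g f) (vβL κ Φ t p D g f) *
        ((5 * (P.r 1 : ℤ) + 10 * u₁A κ Φ t p D g f * (j : ℤ) + 3 - lev) - F1cA κ Φ t p D g f yL) ≤
      u₁A κ Φ t p D g f * ((shearUnit (nL κ Φ t p D g f) (hL κ Φ t p D g f) : ℤ) *
          (ySLo (nL κ Φ t p D g f) (ℓL κ Φ t p D g f) (hL κ Φ t p D g f) qB (KS0.R'0N κ Φ (KS.NQ Φ) t p D mk) 1 k - 1)) -
        modulus (nL κ Φ t p D g f) (hL κ Φ t p D g f) (vL κ Φ t p D g f) (vβL κ Φ t p D g f) + 1 := by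
  obtain ⟨hn1, hℓ1⟩ := one_le_of_eqNumL κ Φ t p D g f hN
  have hm0 : 0 < modulus (nL κ Φ t p D g f) (hL κ Φ t p D g f) (vL κ Φ t p D g f) (vβL κ Φ t p D g f) := Skelφ.NegPrm.modulus_vβOf_pos hn1 hℓ1 _ _
  have hu : 1 ≤ u₁A κ Φ t p D g f := (units_eqA κ Φ t p D g f).2.2.2.2.2
  obtain ⟨hFlo, -⟩ := F1cA_abs_le κ Φ t p D g f hN yL hΛ₁
  obtain ⟨hlb, -⟩ := ySBox_env κ Φ t p D g f hN (Or.inl rfl : (1 : ℤ) = 1 ∨ (1 : ℤ) = -1) qB (KS0.R'0N κ Φ (KS.NQ Φ) t p D mk) k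
  have herr := ySBox_err_le_Y κ Φ t p D g f mk hN hκ hℓ hqB hk
  have hR0 : (0 : ℤ) ≤ (KS0.R'0N κ Φ (KS.NQ Φ) t p D mk : ℤ) := Nat.cast_nonneg _
  have hk0 : (0 : ℤ) ≤ (k : ℤ) := Nat.cast_nonneg _
  clear hℓ hk hκ hΛ₁ hqB
  set m := modulus (nL κ Φ t p D g f) (hL κ Φ t p D g f) (vL κ Φ t p D g f) (vβL κ Φ t p D g f)
  set u := u₁A κ Φ t p D g f
  set U : ℤ := (shearUnit (nL κ Φ t p D g f) (hL κ Φ t p D g f) : ℤ)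
  set S := ySLo (nL κ Φ t p D g f) (ℓL κ Φ t p D g f) (hL κ Φ t p D g f) qB (KS0.R'0N κ Φ (KS.NQ Φ) t p D mk) 1 k
  set Err := 2 * (k : ℤ) * U + U * (qB : ℕ) + U * (((k : ℤ) + 1) * (KS0.R'0N κ Φ (KS.NQ Φ) t p D mk : ℕ)) + 3 * ((nL κ Φ t p D g f : ℤ) * ℓL κ Φ t p D g f) + U
  set F := F1cA κ Φ t p D g f yL
  set R : ℤ := (KS0.R'0N κ Φ (KS.NQ Φ) t p D mk : ℤ)
  set r : ℤ := (P.r 1 : ℤ)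
  have h1 : u * (1 * (k : ℤ) * m - Err - U) ≤ u * (U * (S - 1)) := mul_le_mul_of_nonneg_left (by linarith) (by linarith)
  have h2 : u * (Err + U) ≤ u * (5 * m) := mul_le_mul_of_nonneg_left herr (by linarith)
  have h3 : m * ((5 * r + 10 * u * (j : ℤ) + 3 - lev) - F) ≤ m * (4 - 7 * u + E) := by
    refine mul_le_mul_of_nonneg_left ?_ hm0.le
    have : 10 * u * ((j : ℤ) + 1) = 10 * u * (j : ℤ) + 10 * u := by ring
    linarith
  have h4 : m * E ≤ m * (2 * R) := mul_le_mul_of_nonneg_left hE hm0.le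
  have h5 : m * (6 * R + 11) ≤ m * u := mul_le_mul_of_nonneg_left hs1 hm0.le
  have h6 : 0 ≤ u * ((k : ℤ) * m) := mul_nonneg (by linarith) (mul_nonneg hk0 hm0.le)
  nlinarith [h1, h2, h3, h4, h5, h6, hm0]

/-- **`FA2` at the (ζ′) y′-face tuple** (`σ = 1`): the upper along reading of region `k ≤ Nr` is below `fhi`, given the count's far-end fact
`hfar : F1cA yL + u₁·(Nr+1) ≤ 20r₁ − lev + 2u₁` (hp-8's `NrY_spec` ∘ `T1Y_eq`). [cite: KozmaNitzan2024, §4 Lemma 12 (pp. 23–25)] -/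
theorem FA2_YA (κ : Consts) {V : Type} [DecidableEq V] [Countable V] {G : SimpleGraph V} [G.LocallyFinite] (Φ : PlanarSkeletonFrmQuasi G) (t : V) (p : unitInterval) (D : Skelφ.StepI.DataNS V) (g : ℕ) (f : ℕ) (P : PCells2T) (hP : P.toPCells2 = fcellsA κ Φ t p D g f) (mk : ℕ) (hN : EqNumL κ Φ t p D g f) (hκ : (hL κ Φ t p D g f).natAbs ≤ 10 * nL κ Φ t p D g f)
    (hℓ : 22000 * Neg.Kq κ * (KS0.R'0N κ Φ (KS.NQ Φ) t p D mk + 2) ≤ ℓL κ Φ t p D g f) (yL : Site 2) {qB : ℕ}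
    (hqB : 4 * ((shearUnit (nL κ Φ t p D g f) (hL κ Φ t p D g f) : ℤ) * (qB : ℤ)) ≤ 5 * ((nL κ Φ t p D g f : ℤ) * ℓL κ Φ t p D g f))
    {lev : ℤ} {Nr : ℕ} (hNr : Nr + 1 ≤ 1000 * Neg.Kq κ)
    (hfar : F1cA κ Φ t p D g f yL + u₁A κ Φ t p D g f * ((Nr : ℤ) + 1) ≤ 20 * (P.r 1 : ℤ) - lev + 2 * u₁A κ Φ t p D g f)
    {k : ℕ} (hk : k ≤ Nr) :
    modulus (nL κ Φ t p D g f) (hL κ Φ t p D g f) (vL κ Φ t p D g f) (vβL κ Φ t p D g f) * (F1cA κ Φ t p D g f yL + 1) +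
        u₁A κ Φ t p D g f * ((shearUnit (nL κ Φ t p D g f) (hL κ Φ t p D g f) : ℤ) *
            ySHi (nL κ Φ t p D g f) (ℓL κ Φ t p D g f) (hL κ Φ t p D g f) qB (KS0.R'0N κ Φ (KS.NQ Φ) t p D mk) 1 k +
          shearUnit (nL κ Φ t p D g f) (hL κ Φ t p D g f) - 1) ≤
      modulus (nL κ Φ t p D g f) (hL κ Φ t p D g f) (vL κ Φ t p D g f) (vβL κ Φ t p D g f) * (25 * (P.r 1 : ℤ) - 2 - lev) := by
  obtain ⟨hn1, hℓ1⟩ := one_le_of_eqNumL κ Φ t p D g f hN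
  have hm0 : 0 < modulus (nL κ Φ t p D g f) (hL κ Φ t p D g f) (vL κ Φ t p D g f) (vβL κ Φ t p D g f) := Skelφ.NegPrm.modulus_vβOf_pos hn1 hℓ1 _ _
  have hu : 1 ≤ u₁A κ Φ t p D g f := (units_eqA κ Φ t p D g f).2.2.2.2.2
  have hr : (P.r 1 : ℤ) = 40 * (Neg.Kq κ : ℤ) * u₁A κ Φ t p D g f := by rw [(cells_of_hP κ Φ t p D g f P hP).1 1]; exact (units_eqA κ Φ t p D g f).2.2.2.1
  have hKq : (1 : ℤ) ≤ (Neg.Kq κ : ℤ) := by exact_mod_cast Neg.one_le_Kq κ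
  have hkK : k + 1 ≤ 1000 * Neg.Kq κ := le_trans (by omega) hNr
  obtain ⟨-, hub⟩ := ySBox_env κ Φ t p D g f hN (Or.inl rfl : (1 : ℤ) = 1 ∨ (1 : ℤ) = -1) qB (KS0.R'0N κ Φ (KS.NQ Φ) t p D mk) k
  have herr := ySBox_err_le_Y κ Φ t p D g f mk hN hκ hℓ hqB hkK
  have hk' : (k : ℤ) ≤ (Nr : ℤ) := by exact_mod_cast hk
  clear hℓ hk hκ hqB hkK hNr
  set m := modulus (nL κ Φ t p D g f) (hL κ Φ t p D g f) (vL κ Φ t p D g f) (vβL κ Φ t p D g f)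
  set u := u₁A κ Φ t p D g f
  set U : ℤ := (shearUnit (nL κ Φ t p D g f) (hL κ Φ t p D g f) : ℤ)
  set S := ySHi (nL κ Φ t p D g f) (ℓL κ Φ t p D g f) (hL κ Φ t p D g f) qB (KS0.R'0N κ Φ (KS.NQ Φ) t p D mk) 1 k
  set Err := 2 * (k : ℤ) * U + U * (qB : ℕ) + U * (((k : ℤ) + 1) * (KS0.R'0N κ Φ (KS.NQ Φ) t p D mk : ℕ)) + 3 * ((nL κ Φ t p D g f : ℤ) * ℓL κ Φ t p D g f) + U
  set F := F1cA κ Φ t p D g f yL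
  set r : ℤ := (P.r 1 : ℤ)
  set Q : ℤ := (Neg.Kq κ : ℤ)
  have h1 : u * (U * S + U - 1) ≤ u * (1 * (k : ℤ) * m + Err + U) := mul_le_mul_of_nonneg_left (by linarith) (by linarith)
  have h2 : u * (Err + U) ≤ u * (5 * m) := mul_le_mul_of_nonneg_left herr (by linarith)
  have hku : u * (k : ℤ) ≤ u * (Nr : ℤ) := mul_le_mul_of_nonneg_left hk' (by linarith)
  have h3 : m * (F + u * (k : ℤ) + 5 * u + 1) ≤ m * (25 * r - 2 - lev) := by
    refine mul_le_mul_of_nonneg_left ?_ hm0.le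
    have hQu : 40 * u ≤ 40 * Q * u := by nlinarith
    nlinarith
  nlinarith [h1, h2, h3, hm0]

/-- **`FA3` at the (ζ′) y′-face tuple** (`σ = −1`): mirror of `FA1` (the run descends; readings negated). [cite: KozmaNitzan2024, §4 Lemma 12 (pp. 23–25)] -/
theorem FA3_YA (κ : Consts) {V : Type} [DecidableEq V] [Countable V] {G : SimpleGraph V} [G.LocallyFinite] (Φ : PlanarSkeletonFrmQuasi G) (t : V) (p : unitInterval) (D : Skelφ.StepI.DataNS V) (g : ℕ) (f : ℕ) (P : PCells2T) (mk : ℕ) (hN : EqNumL κ Φ t p D g f) (hκ : (hL κ Φ t p D g f).natAbs ≤ 10 * nL κ Φ t p D g f)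
    (hℓ : 22000 * Neg.Kq κ * (KS0.R'0N κ Φ (KS.NQ Φ) t p D mk + 2) ≤ ℓL κ Φ t p D g f) (hs1 : 6 * (KS0.R'0N κ Φ (KS.NQ Φ) t p D mk : ℤ) + 11 ≤ u₁A κ Φ t p D g f) (yL : Site 2)
    (hΛ₁ : |Λ₁of κ Φ t p D g f yL| ≤ 3 * modulus (nL κ Φ t p D g f) (hL κ Φ t p D g f) (vL κ Φ t p D g f) (vβL κ Φ t p D g f)) {qB : ℕ}
    (hqB : 4 * ((shearUnit (nL κ Φ t p D g f) (hL κ Φ t p D g f) : ℤ) * (qB : ℤ)) ≤ 5 * ((nL κ Φ t p D g f : ℤ) * ℓL κ Φ t p D g f))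
    {lev E : ℤ} {j : ℕ} (hE : E ≤ 2 * (KS0.R'0N κ Φ (KS.NQ Φ) t p D mk : ℤ))
    (hlev : 5 * (P.r 1 : ℤ) + 10 * u₁A κ Φ t p D g f * ((j : ℤ) + 1) - 1 - E ≤ lev) {k : ℕ} (hk : k + 1 ≤ 1000 * Neg.Kq κ) :
    modulus (nL κ Φ t p D g f) (hL κ Φ t p D g f) (vL κ Φ t p D g f) (vβL κ Φ t p D g f) *
        ((5 * (P.r 1 : ℤ) + 10 * u₁A κ Φ t p D g f * (j : ℤ) + 3 - lev) + F1cA κ Φ t p D g f yL + 1) ≤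
      -(u₁A κ Φ t p D g f * ((shearUnit (nL κ Φ t p D g f) (hL κ Φ t p D g f) : ℤ) *
            ySHi (nL κ Φ t p D g f) (ℓL κ Φ t p D g f) (hL κ Φ t p D g f) qB (KS0.R'0N κ Φ (KS.NQ Φ) t p D mk) (-1) k +
          shearUnit (nL κ Φ t p D g f) (hL κ Φ t p D g f) - 1)) := by
  obtain ⟨hn1, hℓ1⟩ := one_le_of_eqNumL κ Φ t p D g f hN
  have hm0 : 0 < modulus (nL κ Φ t p D g f) (hL κ Φ t p D g f) (vL κ Φ t p D g f) (vβL κ Φ t p D g f) := Skelφ.NegPrm.modulus_vβOf_pos hn1 hℓ1 _ _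
  have hu : 1 ≤ u₁A κ Φ t p D g f := (units_eqA κ Φ t p D g f).2.2.2.2.2
  obtain ⟨-, hFhi⟩ := F1cA_abs_le κ Φ t p D g f hN yL hΛ₁
  obtain ⟨-, hub⟩ := ySBox_env κ Φ t p D g f hN (Or.inr rfl : (-1 : ℤ) = 1 ∨ (-1 : ℤ) = -1) qB (KS0.R'0N κ Φ (KS.NQ Φ) t p D mk) k
  have herr := ySBox_err_le_Y κ Φ t p D g f mk hN hκ hℓ hqB hk
  have hR0 : (0 : ℤ) ≤ (KS0.R'0N κ Φ (KS.NQ Φ) t p D mk : ℤ) := Nat.cast_nonneg _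
  have hk0 : (0 : ℤ) ≤ (k : ℤ) := Nat.cast_nonneg _
  clear hℓ hk hκ hΛ₁ hqB
  set m := modulus (nL κ Φ t p D g f) (hL κ Φ t p D g f) (vL κ Φ t p D g f) (vβL κ Φ t p D g f)
  set u := u₁A κ Φ t p D g f
  set U : ℤ := (shearUnit (nL κ Φ t p D g f) (hL κ Φ t p D g f) : ℤ)
  set S := ySHi (nL κ Φ t p D g f) (ℓL κ Φ t p D g f) (hL κ Φ t p D g f) qB (KS0.R'0N κ Φ (KS.NQ Φ) t p D mk) (-1) k
  set Err := 2 * (k : ℤ) * U + U * (qB : ℕ) + U * (((k : ℤ) + 1) * (KS0.R'0N κ Φ (KS.NQ Φ) t p D mk : ℕ)) + 3 * ((nL κ Φ t p D g f : ℤ) * ℓL κ Φ t p D g f) + U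
  set F := F1cA κ Φ t p D g f yL
  set R : ℤ := (KS0.R'0N κ Φ (KS.NQ Φ) t p D mk : ℤ)
  set r : ℤ := (P.r 1 : ℤ)
  have h1 : u * (U * S + U - 1) ≤ u * (-1 * (k : ℤ) * m + Err + U) := mul_le_mul_of_nonneg_left (by linarith) (by linarith)
  have h2 : u * (Err + U) ≤ u * (5 * m) := mul_le_mul_of_nonneg_left herr (by linarith)
  have h3 : m * ((5 * r + 10 * u * (j : ℤ) + 3 - lev) + F + 1) ≤ m * (5 - 7 * u + E) := by
    refine mul_le_mul_of_nonneg_left ?_ hm0.le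
    have : 10 * u * ((j : ℤ) + 1) = 10 * u * (j : ℤ) + 10 * u := by ring
    linarith
  have h4 : m * E ≤ m * (2 * R) := mul_le_mul_of_nonneg_left hE hm0.le
  have h5 : m * (6 * R + 11) ≤ m * u := mul_le_mul_of_nonneg_left hs1 hm0.le
  have h6 : 0 ≤ u * ((k : ℤ) * m) := mul_nonneg (by linarith) (mul_nonneg hk0 hm0.le)
  nlinarith [h1, h2, h3, h4, h5, h6, hm0]

/-- **`FA4` at the (ζ′) y′-face tuple** (`σ = −1`): mirror of `FA2`, given `hfar : −F1cA yL + u₁·(Nr+1) ≤ 20r₁ − lev + 2u₁`.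
[cite: KozmaNitzan2024, §4 Lemma 12 (pp. 23–25)] -/
theorem FA4_YA (κ : Consts) {V : Type} [DecidableEq V] [Countable V] {G : SimpleGraph V} [G.LocallyFinite] (Φ : PlanarSkeletonFrmQuasi G) (t : V) (p : unitInterval) (D : Skelφ.StepI.DataNS V) (g : ℕ) (f : ℕ) (P : PCells2T) (hP : P.toPCells2 = fcellsA κ Φ t p D g f) (mk : ℕ) (hN : EqNumL κ Φ t p D g f) (hκ : (hL κ Φ t p D g f).natAbs ≤ 10 * nL κ Φ t p D g f)
    (hℓ : 22000 * Neg.Kq κ * (KS0.R'0N κ Φ (KS.NQ Φ) t p D mk + 2) ≤ ℓL κ Φ t p D g f) (yL : Site 2) {qB : ℕ}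
    (hqB : 4 * ((shearUnit (nL κ Φ t p D g f) (hL κ Φ t p D g f) : ℤ) * (qB : ℤ)) ≤ 5 * ((nL κ Φ t p D g f : ℤ) * ℓL κ Φ t p D g f))
    {lev : ℤ} {Nr : ℕ} (hNr : Nr + 1 ≤ 1000 * Neg.Kq κ)
    (hfar : -F1cA κ Φ t p D g f yL + u₁A κ Φ t p D g f * ((Nr : ℤ) + 1) ≤ 20 * (P.r 1 : ℤ) - lev + 2 * u₁A κ Φ t p D g f)
    {k : ℕ} (hk : k ≤ Nr) :
    -(modulus (nL κ Φ t p D g f) (hL κ Φ t p D g f) (vL κ Φ t p D g f) (vβL κ Φ t p D g f) * F1cA κ Φ t p D g f yL) -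
          u₁A κ Φ t p D g f * ((shearUnit (nL κ Φ t p D g f) (hL κ Φ t p D g f) : ℤ) *
            (ySLo (nL κ Φ t p D g f) (ℓL κ Φ t p D g f) (hL κ Φ t p D g f) qB (KS0.R'0N κ Φ (KS.NQ Φ) t p D mk) (-1) k - 1)) +
        modulus (nL κ Φ t p D g f) (hL κ Φ t p D g f) (vL κ Φ t p D g f) (vβL κ Φ t p D g f) - 1 ≤
      modulus (nL κ Φ t p D g f) (hL κ Φ t p D g f) (vL κ Φ t p D g f) (vβL κ Φ t p D g f) * (25 * (P.r 1 : ℤ) - 2 - lev) := by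
  obtain ⟨hn1, hℓ1⟩ := one_le_of_eqNumL κ Φ t p D g f hN
  have hm0 : 0 < modulus (nL κ Φ t p D g f) (hL κ Φ t p D g f) (vL κ Φ t p D g f) (vβL κ Φ t p D g f) := Skelφ.NegPrm.modulus_vβOf_pos hn1 hℓ1 _ _
  have hu : 1 ≤ u₁A κ Φ t p D g f := (units_eqA κ Φ t p D g f).2.2.2.2.2
  have hr : (P.r 1 : ℤ) = 40 * (Neg.Kq κ : ℤ) * u₁A κ Φ t p D g f := by rw [(cells_of_hP κ Φ t p D g f P hP).1 1]; exact (units_eqA κ Φ t p D g f).2.2.2.1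
  have hKq : (1 : ℤ) ≤ (Neg.Kq κ : ℤ) := by exact_mod_cast Neg.one_le_Kq κ
  have hkK : k + 1 ≤ 1000 * Neg.Kq κ := le_trans (by omega) hNr
  obtain ⟨hlb, -⟩ := ySBox_env κ Φ t p D g f hN (Or.inr rfl : (-1 : ℤ) = 1 ∨ (-1 : ℤ) = -1) qB (KS0.R'0N κ Φ (KS.NQ Φ) t p D mk) k
  have herr := ySBox_err_le_Y κ Φ t p D g f mk hN hκ hℓ hqB hkK
  have hk' : (k : ℤ) ≤ (Nr : ℤ) := by exact_mod_cast hk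
  clear hℓ hk hκ hqB hkK hNr
  set m := modulus (nL κ Φ t p D g f) (hL κ Φ t p D g f) (vL κ Φ t p D g f) (vβL κ Φ t p D g f)
  set u := u₁A κ Φ t p D g f
  set U : ℤ := (shearUnit (nL κ Φ t p D g f) (hL κ Φ t p D g f) : ℤ)
  set S := ySLo (nL κ Φ t p D g f) (ℓL κ Φ t p D g f) (hL κ Φ t p D g f) qB (KS0.R'0N κ Φ (KS.NQ Φ) t p D mk) (-1) k
  set Err := 2 * (k : ℤ) * U + U * (qB : ℕ) + U * (((k : ℤ) + 1) * (KS0.R'0N κ Φ (KS.NQ Φ) t p D mk : ℕ)) + 3 * ((nL κ Φ t p D g f : ℤ) * ℓL κ Φ t p D g f) + U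
  set F := F1cA κ Φ t p D g f yL
  set r : ℤ := (P.r 1 : ℤ)
  set Q : ℤ := (Neg.Kq κ : ℤ)
  have h1 : u * (-1 * (k : ℤ) * m - Err - U) ≤ u * (U * (S - 1)) := mul_le_mul_of_nonneg_left (by linarith) (by linarith)
  have h2 : u * (Err + U) ≤ u * (5 * m) := mul_le_mul_of_nonneg_left herr (by linarith)
  have hku : u * (k : ℤ) ≤ u * (Nr : ℤ) := mul_le_mul_of_nonneg_left hk' (by linarith)
  have h3 : m * (-F + u * (k : ℤ) + 5 * u + 1) ≤ m * (25 * r - 2 - lev) := by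
    refine mul_le_mul_of_nonneg_left ?_ hm0.le
    have hQu : 40 * u ≤ 40 * Q * u := by nlinarith
    nlinarith
  nlinarith [h1, h2, h3, hm0]

end FloorsAY

end KS

end NegB

end PlanarSkeletonFrmQuasi

end Summit.CriticalPhenomena.PercolationContinuityZ3.Theorems.Transplant

end
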